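import Summits.Ventures.CertifiedQuantumChemistry.Rows.OrbitalSignBlockingLossless
import Summits.Ventures.CertifiedQuantumChemistry.Rows.OrbitalRotationExactInvariance
import Summits.Ventures.CertifiedQuantumChemistry.Rows.ConjectureSU
import HarnessLib

/-!
# Ventures/CertifiedQuantumChemistry — Rows/HubbardRingTVHoppingSign.lean: the SUBLATTICE GAUGE —
# on an even ring the exact sector energy and BOTH two-positivity lower bounds are EVEN in the hopping `t`

HONEST FRAMING (verbatim): certified bounds for a stated model Hamiltonian in a stated basis; not a
claim about the real molecule beyond that model.

Seat rdm-B, ROWS courtesy file (theorems only; no `def`, no notation, no instance; zero compute). It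
types the 'exact, no data' structure sentence of `run/shared/lean/pub/pub-qchem/STRUCTURE.md` §2.2.7
('WHY AN ODD POWER IS A STRUCTURE STATEMENT') and §2.2.8 (i)(b): for EVEN `L` the sublattice gauge
`c_{pσ} ↦ (−1)^p c_{pσ}` is a site-diagonal one-body unitary; it maps the TV-H tables
`(−t·A, U·δ, 0)` of `hubbardRingTV L t U` to `(+t·A, U·δ, 0)` (adjacent ring sites have opposite
parity when `L` is even, and the on-site two-electron table carries four equal indices), acts on a
pair `(γ, Γ)` by the sign congruence of `Rows/OrbitalSignBlockingLossless.lean` — which maps the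
`S_z`-sector DQG feasible set and its singlet-restricted (`⟨Ŝ²⟩ = 0`) subset onto themselves — and the
energy functional is COVARIANT, so

* `rdmEnergy_signTwist` — `E_{h,g}(s·γ·s, (s⊗s)Γ(s⊗s)) = E_{h^s,g^s}(γ, Γ)` with the sign-twisted
  tables `h^s_pq = s_p s_q h_pq`, `g^s_pqrw = s_p s_q s_r s_w g_pqrw` (any `s : Λ → ℂ`);
* `isDQGFeasibleSinglet_sign` — the singlet row (98) `Σ_xy Γ_{x↑y↓,y↑x↓} = n` is sign-invariant;
* `pqgSectorEnergy_signTwist`, `pqgSingletEnergy_signTwist` — `E_PQG(h^s, g^s) = E_PQG(h, g)` at both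
  levels (`s = ±1`); `sectorGroundEnergy_signTwist` — the exact sector energy likewise
  (`Rows/OrbitalRotationExactInvariance.sectorGroundEnergy_conj_orbital` at the diagonal unitary `s`);
* **`hubbardRingTV_energy_neg_hopping`**, **`hubbardRingTV_pqgSectorEnergy_neg_hopping`**,
  **`hubbardRingTV_pqgSingletEnergy_neg_hopping`** — for `Even L`:
  `E₀(L; −t, U; a, b) = E₀(L; t, U; a, b)`, `OPT_DQG(L; −t, U; a, b) = OPT_DQG(L; t, U; a, b)`,
  `OPT_DQG+S²(L; −t, U; n) = OPT_DQG+S²(L; t, U; n)` (every sector, every `U`, every `t`);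
* `hubbardRingTV_gap_sector_neg_hopping`, `hubbardRingTV_gap_singlet_neg_hopping` — hence each
  certified gap `E₀ − OPT_X` and the scaled gap `ĉ_X = (U/4t²)(E₀ − OPT_X)` of conjecture S-U are EVEN
  functions of `t`: with the programme's homogeneity `OPT_X(t, U) = U·f_X(t/U)` this is the evenness of
  `f_X` that makes a first-order (odd-power) approach to the strong-coupling plateau a statement about
  NON-analyticity in `(t/U)²` (STRUCTURE §2.2.7, N-3) — the reading itself is NOT typed here.

READING: statements about the ABSTRACT programme values and the exact energy of the cell's own model
object `hubbardRingTV`; no certificate, row, hint, claim node or value of record depends on them; the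
conjecture leaves `Rows/ConjectureSU(2).lean` are imported for the SPELLING `Model.pqgSectorEnergy` /
`Model.pqgSingletEnergy` only and are untouched. Odd `L` is not covered (the gauge is frustrated on an
odd ring; nothing is claimed there). Everything is PROVED (0 sorry, standard axioms).

References: E. H. Lieb, Phys. Rev. Lett. 62 (1989) 1201, proof of Thm 1 (the bipartite sign gauge
`t ↦ −t`); D. A. Mazziotti, Adv. Chem. Phys. 134 (2007) ch. 3 §II.F eq. (95) (sign characters on
reduced density matrices). Tree (REUSED): `isDQGFeasibleSector_sign`, `sign_mul_self`, `star_sign`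
(`Rows/OrbitalSignBlockingLossless`); `sectorGroundEnergy_conj_orbital`
(`Rows/OrbitalRotationExactInvariance`); `rdmEnergy`, `IsDQGFeasibleSinglet`, `pqgSectorEnergy`,
`pqgSingletEnergy` (Literature `VariationalRDMRelaxation` / `SingletRestrictedRelaxation` /
`RelaxationEnergyHierarchy`); `hubbardRingTV`, `ringAdj` (`Hamiltonians/HubbardRingTV`);
`Model.energy`, `Model.pqgSectorEnergy`, `Model.pqgSingletEnergy` (`Statement`, `Rows/ConjectureSU`).
-/

noncomputable section

namespace Summit.Ventures.CertifiedQuantumChemistry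

open Matrix Finset
open Literature.MathematicalPhysics.QuantumLattice Literature.MathematicalPhysics.QuantumChemistry
open Summit.Ventures.CertifiedQuantumChemistry.Hamiltonians
open scoped ComplexOrder

/-! ## §1 Sign twists of the integral tables: covariance of the functional, invariance of the values -/

section Abstract

variable {Λ : Type*} [LinearOrder Λ] [Fintype Λ]

omit [LinearOrder Λ] in
/-- **Covariance of the energy functional under a sign congruence.** For ANY `s : Λ → ℂ`
(spin-independent, `χ_{pσ} = s_p`): the functional of the tables `(h, g)` at the twisted pair
`(s·γ·s, (s⊗s)Γ(s⊗s))` is the functional of the TWISTED tables `h^s_pq = s_p s_q h_pq`,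
`g^s_pqrw = s_p s_q s_r s_w g_pqrw` at `(γ, Γ)`. -/
theorem rdmEnergy_signTwist (s : Λ → ℂ) (h : Λ → Λ → ℂ) (g : Λ → Λ → Λ → Λ → ℂ) (hnuc : ℂ)
    (γ : Matrix (Orb Λ) (Orb Λ) ℂ) (Γ : Matrix (Orb Λ × Orb Λ) (Orb Λ × Orb Λ) ℂ) :
    rdmEnergy h g hnuc (Matrix.of fun i k => s (ofLex i).1 * s (ofLex k).1 * γ i k)
        (Matrix.of fun p q => s (ofLex p.1).1 * s (ofLex p.2).1 *
          (s (ofLex q.1).1 * s (ofLex q.2).1) * Γ p q) =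
      rdmEnergy (fun p q => s p * s q * h p q) (fun p q r w => s p * s q * s r * s w * g p q r w) hnuc γ Γ := by
  have h1 : ∀ p q : Λ, h p q * ∑ σ : Fin 2,
      (Matrix.of fun i k : Orb Λ => s (ofLex i).1 * s (ofLex k).1 * γ i k) (orb p σ) (orb q σ) =
        s p * s q * h p q * ∑ σ : Fin 2, γ (orb p σ) (orb q σ) := by
    intro p q
    simp only [Matrix.of_apply, orb, ofLex_toLex, ← Finset.mul_sum]
    ring
  have h2 : ∀ p q r w : Λ, g p q r w * ∑ σ : Fin 2, ∑ τ : Fin 2,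
      (Matrix.of fun P Q : Orb Λ × Orb Λ => s (ofLex P.1).1 * s (ofLex P.2).1 *
        (s (ofLex Q.1).1 * s (ofLex Q.2).1) * Γ P Q) (orb p σ, orb r τ) (orb q σ, orb w τ) =
        s p * s q * s r * s w * g p q r w *
          ∑ σ : Fin 2, ∑ τ : Fin 2, Γ (orb p σ, orb r τ) (orb q σ, orb w τ) := by
    intro p q r w
    simp only [Matrix.of_apply, orb, ofLex_toLex, ← Finset.mul_sum]
    ring
  unfold rdmEnergy
  simp only [h1, h2]

omit [LinearOrder Λ] [Fintype Λ] in
/-- Twisting twice by signs `s = ±1` returns the one-electron table. -/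
theorem signTwist_signTwist_h {s : Λ → ℂ} (hs : ∀ p, s p = 1 ∨ s p = -1) (h : Λ → Λ → ℂ) :
    (fun p q => s p * s q * (s p * s q * h p q)) = h := by
  funext p q
  have hss := sign_mul_self hs
  linear_combination (s q * s q * h p q) * hss p + h p q * hss q

omit [LinearOrder Λ] [Fintype Λ] in
/-- Twisting twice by signs `s = ±1` returns the two-electron table. -/
theorem signTwist_signTwist_g {s : Λ → ℂ} (hs : ∀ p, s p = 1 ∨ s p = -1) (g : Λ → Λ → Λ → Λ → ℂ) :
    (fun p q r w => s p * s q * s r * s w * (s p * s q * s r * s w * g p q r w)) = g := by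
  funext p q r w
  have hss := sign_mul_self hs
  linear_combination (s q * s q * (s r * s r) * (s w * s w) * g p q r w) * hss p +
    (s r * s r * (s w * s w) * g p q r w) * hss q + (s w * s w * g p q r w) * hss r + g p q r w * hss w

/-- **The singlet-restricted feasible set is invariant under a spin-independent sign congruence**:
the `S`-representability row (98) `Σ_xy Γ_{x↑ y↓, y↑ x↓} = n` picks up the factor
`s_x s_y s_y s_x = 1`. -/
theorem isDQGFeasibleSinglet_sign {s : Λ → ℂ} (hs : ∀ p, s p = 1 ∨ s p = -1) {n : ℕ}
    {γ : Matrix (Orb Λ) (Orb Λ) ℂ} {Γ : Matrix (Orb Λ × Orb Λ) (Orb Λ × Orb Λ) ℂ}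
    (hf : IsDQGFeasibleSinglet n γ Γ) :
    IsDQGFeasibleSinglet n (Matrix.of fun i k => s (ofLex i).1 * s (ofLex k).1 * γ i k)
      (Matrix.of fun p q => s (ofLex p.1).1 * s (ofLex p.2).1 *
        (s (ofLex q.1).1 * s (ofLex q.2).1) * Γ p q) where
  toIsDQGFeasibleSector :=
    isDQGFeasibleSector_sign (χ := fun i : Orb Λ => s (ofLex i).1) (fun i => hs _) hf.toIsDQGFeasibleSector
  exchange_sum := by
    have hss := sign_mul_self hs
    have h4 : ∀ x y : Λ, s x * s y * (s y * s x) = 1 := fun x y => by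
      linear_combination (s y * s y) * hss x + hss y
    simp only [Matrix.of_apply, orb, ofLex_toLex, h4, one_mul]
    exact hf.exchange_sum

/-- **The `S_z`-sector DQG value is invariant under a sign twist of the tables** (`s = ±1`):
`E_PQG(h^s, g^s; N_α, N_β) = E_PQG(h, g; N_α, N_β)` — the feasible set is mapped onto itself by the
sign congruence and the functional is covariant. -/
theorem pqgSectorEnergy_signTwist {s : Λ → ℂ} (hs : ∀ p, s p = 1 ∨ s p = -1) (h : Λ → Λ → ℂ)
    (g : Λ → Λ → Λ → Λ → ℂ) (hnuc : ℂ) (a b : ℕ) :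
    pqgSectorEnergy (fun p q => s p * s q * h p q) (fun p q r w => s p * s q * s r * s w * g p q r w) hnuc a b =
      pqgSectorEnergy h g hnuc a b := by
  have hχ : ∀ i : Orb Λ, s (ofLex i).1 = 1 ∨ s (ofLex i).1 = -1 := fun i => hs _
  unfold pqgSectorEnergy
  congr 1
  ext E
  constructor
  · rintro ⟨γ, Γ, hf, rfl⟩
    exact ⟨_, _, isDQGFeasibleSector_sign hχ hf, by rw [rdmEnergy_signTwist]⟩
  · rintro ⟨γ, Γ, hf, rfl⟩
    refine ⟨_, _, isDQGFeasibleSector_sign hχ hf, ?_⟩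
    rw [rdmEnergy_signTwist, signTwist_signTwist_h hs, signTwist_signTwist_g hs]

/-- **The singlet-restricted DQG value is invariant under a sign twist of the tables** (`s = ±1`):
`E_PQG(h^s, g^s; 2n, S = 0) = E_PQG(h, g; 2n, S = 0)`. -/
theorem pqgSingletEnergy_signTwist {s : Λ → ℂ} (hs : ∀ p, s p = 1 ∨ s p = -1) (h : Λ → Λ → ℂ)
    (g : Λ → Λ → Λ → Λ → ℂ) (hnuc : ℂ) (n : ℕ) :
    pqgSingletEnergy (fun p q => s p * s q * h p q) (fun p q r w => s p * s q * s r * s w * g p q r w) hnuc n =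
      pqgSingletEnergy h g hnuc n := by
  unfold pqgSingletEnergy
  congr 1
  ext E
  constructor
  · rintro ⟨γ, Γ, hf, rfl⟩
    exact ⟨_, _, isDQGFeasibleSinglet_sign hs hf, by rw [rdmEnergy_signTwist]⟩
  · rintro ⟨γ, Γ, hf, rfl⟩
    refine ⟨_, _, isDQGFeasibleSinglet_sign hs hf, ?_⟩
    rw [rdmEnergy_signTwist, signTwist_signTwist_h hs, signTwist_signTwist_g hs]

/-- The diagonal sign matrix on the spin orbitals is unitary. -/
theorem diagonal_sign_mul_conjTranspose {s : Λ → ℂ} (hs : ∀ p, s p = 1 ∨ s p = -1) :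
    (Matrix.diagonal fun i : Orb Λ => s (ofLex i).1) * (Matrix.diagonal fun i : Orb Λ => s (ofLex i).1)ᴴ = 1 := by
  rw [Matrix.diagonal_conjTranspose, Matrix.diagonal_mul_diagonal, ← Matrix.diagonal_one]
  congr 1
  funext i
  rw [Pi.star_apply, star_sign hs, sign_mul_self hs]

omit [Fintype Λ] in
/-- The diagonal sign matrix on the spin orbitals is the spin-free lift of the diagonal sign matrix on
the orbitals. -/
theorem diagonal_sign_apply_orb (s : Λ → ℂ) (p q : Λ) (σ τ : Fin 2) :
    (Matrix.diagonal fun i : Orb Λ => s (ofLex i).1) (orb p σ) (orb q τ) =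
      if σ = τ then (Matrix.diagonal s) p q else 0 := by
  classical
  simp only [Matrix.diagonal_apply, orb_eq_orb_iff, orb, ofLex_toLex]
  by_cases hpq : p = q <;> by_cases hστ : σ = τ <;> simp [hpq, hστ]

/-- Rotating the one-electron table by the diagonal sign unitary is the sign twist. -/
theorem rotate_diagonal_sign_h {s : Λ → ℂ} (hs : ∀ p, s p = 1 ∨ s p = -1) (h : Λ → Λ → ℂ) :
    (fun a b => ∑ p, ∑ q, (Matrix.diagonal s) p a * star ((Matrix.diagonal s) q b) * h p q) =
      fun p q => s p * s q * h p q := by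
  classical
  funext a b
  rw [Finset.sum_eq_single a]
  · rw [Finset.sum_eq_single b]
    · rw [Matrix.diagonal_apply_eq, Matrix.diagonal_apply_eq, star_sign hs]
    · intro q _ hq
      rw [Matrix.diagonal_apply_ne _ hq, star_zero, mul_zero, zero_mul]
    · intro hb; exact absurd (Finset.mem_univ b) hb
  · intro p _ hp
    apply Finset.sum_eq_zero
    intro q _
    rw [Matrix.diagonal_apply_ne _ hp, zero_mul, zero_mul]
  · intro ha; exact absurd (Finset.mem_univ a) ha

/-- Rotating the two-electron table by the diagonal sign unitary is the sign twist. -/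
theorem rotate_diagonal_sign_g {s : Λ → ℂ} (hs : ∀ p, s p = 1 ∨ s p = -1) (g : Λ → Λ → Λ → Λ → ℂ) :
    (fun a b c d => ∑ p, ∑ q, ∑ r, ∑ w, (Matrix.diagonal s) p a * star ((Matrix.diagonal s) q b) *
        (Matrix.diagonal s) r c * star ((Matrix.diagonal s) w d) * g p q r w) =
      fun p q r w => s p * s q * s r * s w * g p q r w := by
  classical
  funext a b c d
  have hz : ∀ p q r w, p ≠ a ∨ q ≠ b ∨ r ≠ c ∨ w ≠ d →
      (Matrix.diagonal s) p a * star ((Matrix.diagonal s) q b) * (Matrix.diagonal s) r c *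
        star ((Matrix.diagonal s) w d) * g p q r w = 0 := by
    intro p q r w hne
    rcases hne with h1 | h1 | h1 | h1
    · rw [Matrix.diagonal_apply_ne _ h1]; ring
    · rw [Matrix.diagonal_apply_ne _ h1, star_zero]; ring
    · rw [Matrix.diagonal_apply_ne _ h1]; ring
    · rw [Matrix.diagonal_apply_ne _ h1, star_zero]; ring
  rw [Finset.sum_eq_single a, Finset.sum_eq_single b, Finset.sum_eq_single c, Finset.sum_eq_single d]
  · rw [Matrix.diagonal_apply_eq, Matrix.diagonal_apply_eq, Matrix.diagonal_apply_eq,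
      Matrix.diagonal_apply_eq, star_sign hs, star_sign hs]
  · exact fun w _ hw => hz a b c w (Or.inr (Or.inr (Or.inr hw)))
  · exact fun h => absurd (Finset.mem_univ d) h
  · exact fun r _ hr => Finset.sum_eq_zero fun w _ => hz a b r w (Or.inr (Or.inr (Or.inl hr)))
  · exact fun h => absurd (Finset.mem_univ c) h
  · exact fun q _ hq => Finset.sum_eq_zero fun r _ => Finset.sum_eq_zero fun w _ =>
      hz a q r w (Or.inr (Or.inl hq))
  · exact fun h => absurd (Finset.mem_univ b) h
  · exact fun p _ hp => Finset.sum_eq_zero fun q _ => Finset.sum_eq_zero fun r _ =>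
      Finset.sum_eq_zero fun w _ => hz p q r w (Or.inl hp)
  · exact fun h => absurd (Finset.mem_univ a) h

/-- **The exact sector energy is invariant under a sign twist of the tables** (`s = ±1`):
`E₀(Ĥ(h^s, g^s); N_α, N_β) = E₀(Ĥ(h, g); N_α, N_β)` — the sign gauge is a diagonal one-body unitary,
so this is `sectorGroundEnergy_conj_orbital` at `u = diag(s)`. -/
theorem sectorGroundEnergy_signTwist {s : Λ → ℂ} (hs : ∀ p, s p = 1 ∨ s p = -1) (h : Λ → Λ → ℂ)
    (g : Λ → Λ → Λ → Λ → ℂ) (hnuc : ℂ) (a b : ℕ) :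
    sectorGroundEnergy (molecularHamiltonian (fun p q => s p * s q * h p q)
        (fun p q r w => s p * s q * s r * s w * g p q r w) hnuc) a b =
      sectorGroundEnergy (molecularHamiltonian h g hnuc) a b := by
  rw [← rotate_diagonal_sign_h hs h, ← rotate_diagonal_sign_g hs g]
  exact sectorGroundEnergy_conj_orbital (diagonal_sign_mul_conjTranspose hs)
    (diagonal_sign_apply_orb s) h g hnuc a b

end Abstract

/-! ## §2 The sublattice gauge of an even ring -/

namespace HoppingSign

/-- **On an EVEN ring adjacent sites have opposite sublattice signs**: `ringAdj L p q → (−1)^p (−1)^q = −1`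
(the bond closing the ring joins `L − 1`, odd, to `0`, even). -/
theorem sign_mul_sign_of_ringAdj {L : ℕ} (hL : Even L) {p q : Fin L} (hpq : Hamiltonians.ringAdj L p q) :
    (-1 : ℂ) ^ p.val * (-1 : ℂ) ^ q.val = -1 := by
  -- one step along the ring flips the parity, including across the closing bond when `L` is even
  have step : ∀ {x y : Fin L}, (x.val + 1) % L = y.val → (-1 : ℂ) ^ x.val * (-1 : ℂ) ^ y.val = -1 := by
    intro x y hxy
    rcases Nat.lt_or_ge (x.val + 1) L with hlt | hge
    · rw [Nat.mod_eq_of_lt hlt] at hxy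
      rw [← hxy, pow_succ, ← mul_assoc, ← pow_add, ← two_mul, pow_mul, neg_one_sq, one_pow, one_mul]
    · have hx : x.val + 1 = L := le_antisymm x.isLt hge
      rw [hx, Nat.mod_self] at hxy
      have hodd : Odd x.val := by
        obtain ⟨m, hm⟩ := hL
        refine ⟨m - 1, ?_⟩
        omega
      rw [← hxy, pow_zero, mul_one, hodd.neg_one_pow]
  rcases hpq with ⟨_, h1 | h1⟩
  · exact step h1
  · rw [mul_comm]; exact step h1

/-- The one-electron table of `hubbardRingTV L (−t) U` is the sublattice sign twist of that of
`hubbardRingTV L t U` (`L` even; as complex tables). -/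
theorem h_neg_hopping {L : ℕ} (hL : Even L) (t U : ℚ) :
    (fun p q => (((hubbardRingTV L (-t) U).h p q : ℚ) : ℂ)) =
      fun p q => (-1 : ℂ) ^ p.val * (-1 : ℂ) ^ q.val * (((hubbardRingTV L t U).h p q : ℚ) : ℂ) := by
  funext p q
  simp only [hubbardRingTV]
  by_cases hpq : Hamiltonians.ringAdj L p q
  · rw [if_pos hpq, if_pos hpq, sign_mul_sign_of_ringAdj hL hpq]
    push_cast
    ring
  · rw [if_neg hpq, if_neg hpq]
    push_cast
    ring

/-- The two-electron table of the TV-H model is invariant under the sublattice sign twist (its only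
non-zero entries `(pp|pp) = U` carry four equal indices), and does not depend on `t`. -/
theorem eri_neg_hopping (L : ℕ) (t U : ℚ) :
    (fun p q r w => (((hubbardRingTV L (-t) U).eri p q r w : ℚ) : ℂ)) =
      fun p q r w => (-1 : ℂ) ^ p.val * (-1 : ℂ) ^ q.val * (-1 : ℂ) ^ r.val * (-1 : ℂ) ^ w.val *
        (((hubbardRingTV L t U).eri p q r w : ℚ) : ℂ) := by
  funext p q r w
  simp only [hubbardRingTV]
  by_cases hc : p = q ∧ q = r ∧ r = w
  · obtain ⟨rfl, rfl, rfl⟩ := hc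
    have hss := sign_mul_self (fun x : Fin L => neg_one_pow_eq_or ℂ x.val) p
    rw [if_pos ⟨rfl, rfl, rfl⟩]
    linear_combination (-((-1 : ℂ) ^ p.val * (-1 : ℂ) ^ p.val * ((U : ℚ) : ℂ))) * hss -
      ((U : ℚ) : ℂ) * hss
  · rw [if_neg hc]
    push_cast
    ring

/-- The scalar of the TV-H model is `0` at every hopping. -/
theorem ecore_neg_hopping (L : ℕ) (t U : ℚ) :
    (((hubbardRingTV L (-t) U).ecore : ℚ) : ℂ) = (((hubbardRingTV L t U).ecore : ℚ) : ℂ) := rfl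

end HoppingSign

open HoppingSign

/-! ## §3 Evenness in `t` of the exact energy and of both lower bounds on an even ring -/

/-- **THE EXACT SECTOR ENERGY OF AN EVEN HUBBARD RING IS EVEN IN THE HOPPING**:
`E₀(hubbardRingTV L (−t) U; a, b) = E₀(hubbardRingTV L t U; a, b)` for even `L`, every sector
`(a, b)`, every `t, U ∈ ℚ` (the sublattice gauge; Lieb 1989). -/
theorem hubbardRingTV_energy_neg_hopping {L : ℕ} (hL : Even L) (t U : ℚ) (a b : ℕ) :
    Model.energy (hubbardRingTV L (-t) U) a b = Model.energy (hubbardRingTV L t U) a b := by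
  unfold Model.energy Model.hamiltonian
  rw [h_neg_hopping hL t U, eri_neg_hopping L t U, ecore_neg_hopping L t U]
  exact sectorGroundEnergy_signTwist (fun x : Fin L => neg_one_pow_eq_or ℂ x.val) _ _ _ a b

/-- **THE `S_z`-SECTOR DQG LOWER BOUND OF AN EVEN HUBBARD RING IS EVEN IN THE HOPPING**:
`OPT_DQG(hubbardRingTV L (−t) U; a, b) = OPT_DQG(hubbardRingTV L t U; a, b)` for even `L`
(STRUCTURE §2.2.7: `OPT_X(L; −t, U) = OPT_X(L; t, U)` exactly). -/
theorem hubbardRingTV_pqgSectorEnergy_neg_hopping {L : ℕ} (hL : Even L) (t U : ℚ) (a b : ℕ) :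
    Model.pqgSectorEnergy (hubbardRingTV L (-t) U) a b =
      Model.pqgSectorEnergy (hubbardRingTV L t U) a b := by
  unfold Model.pqgSectorEnergy
  rw [h_neg_hopping hL t U, eri_neg_hopping L t U, ecore_neg_hopping L t U]
  exact pqgSectorEnergy_signTwist (fun x : Fin L => neg_one_pow_eq_or ℂ x.val) _ _ _ a b

/-- **THE SINGLET-RESTRICTED (`⟨Ŝ²⟩ = 0`) DQG LOWER BOUND OF AN EVEN HUBBARD RING IS EVEN IN THE
HOPPING**: `OPT_DQG+S²(hubbardRingTV L (−t) U; n) = OPT_DQG+S²(hubbardRingTV L t U; n)` for even `L`. -/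
theorem hubbardRingTV_pqgSingletEnergy_neg_hopping {L : ℕ} (hL : Even L) (t U : ℚ) (n : ℕ) :
    Model.pqgSingletEnergy (hubbardRingTV L (-t) U) n =
      Model.pqgSingletEnergy (hubbardRingTV L t U) n := by
  unfold Model.pqgSingletEnergy
  rw [h_neg_hopping hL t U, eri_neg_hopping L t U, ecore_neg_hopping L t U]
  exact pqgSingletEnergy_signTwist (fun x : Fin L => neg_one_pow_eq_or ℂ x.val) _ _ _ n

/-- **The sector gap `E₀ − OPT_DQG` of an even ring is even in `t`.** -/
theorem hubbardRingTV_gap_sector_neg_hopping {L : ℕ} (hL : Even L) (t U : ℚ) (a b : ℕ) :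
    Model.energy (hubbardRingTV L (-t) U) a b - Model.pqgSectorEnergy (hubbardRingTV L (-t) U) a b =
      Model.energy (hubbardRingTV L t U) a b - Model.pqgSectorEnergy (hubbardRingTV L t U) a b := by
  rw [hubbardRingTV_energy_neg_hopping hL, hubbardRingTV_pqgSectorEnergy_neg_hopping hL]

/-- **The singlet gap `E₀ − OPT_DQG+S²` of an even ring at `(n, n)` is even in `t`.** -/
theorem hubbardRingTV_gap_singlet_neg_hopping {L : ℕ} (hL : Even L) (t U : ℚ) (n : ℕ) :
    Model.energy (hubbardRingTV L (-t) U) n n - Model.pqgSingletEnergy (hubbardRingTV L (-t) U) n =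
      Model.energy (hubbardRingTV L t U) n n - Model.pqgSingletEnergy (hubbardRingTV L t U) n := by
  rw [hubbardRingTV_energy_neg_hopping hL, hubbardRingTV_pqgSingletEnergy_neg_hopping hL]

/-- **The scaled gap `ĉ_X(L; t, U) = (U/4t²)·(E₀ − OPT_X)` of conjecture S-U is even in `t` at both
levels** (`L` even; the prefactor is itself even in `t`). -/
theorem hubbardRingTV_scaledGap_neg_hopping {L : ℕ} (hL : Even L) (t U : ℚ) (n : ℕ) :
    ((U : ℝ) / (4 * (-t : ℚ) ^ 2)) *
        (Model.energy (hubbardRingTV L (-t) U) n n - Model.pqgSectorEnergy (hubbardRingTV L (-t) U) n n) =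
      ((U : ℝ) / (4 * (t : ℚ) ^ 2)) *
        (Model.energy (hubbardRingTV L t U) n n - Model.pqgSectorEnergy (hubbardRingTV L t U) n n) ∧
    ((U : ℝ) / (4 * (-t : ℚ) ^ 2)) *
        (Model.energy (hubbardRingTV L (-t) U) n n - Model.pqgSingletEnergy (hubbardRingTV L (-t) U) n) =
      ((U : ℝ) / (4 * (t : ℚ) ^ 2)) *
        (Model.energy (hubbardRingTV L t U) n n - Model.pqgSingletEnergy (hubbardRingTV L t U) n) := by
  rw [hubbardRingTV_gap_sector_neg_hopping hL, hubbardRingTV_gap_singlet_neg_hopping hL, Rat.cast_neg, neg_sq]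
  exact ⟨rfl, rfl⟩

end Summit.Ventures.CertifiedQuantumChemistry

end
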